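import Literature.NumberTheory.Sieve.SelbergSieveGBox
import Literature.NumberTheory.Sieve.FGKMT2018LocalPairSumPeel

/-!
# Multidimensional Selberg sieve on a general box: crude bounds for the local pair sum

Source: J. Maynard, *Dense clusters of primes in subsets*, Compositio Math. 152 (2016) =
arXiv:1405.2593 [Maynard2016DenseClusters], proof of Proposition 9.1 p. 19 (the evaluation (9.5) of
the local pair sum and the count «for each prime `p ∣ A` there are `ω(p) − 1` possible choices of
which component of `s` can be a multiple of `p`») and proof of Proposition 9.4 pp. 25–26 (the same
for `(k+1)`-dimensional vectors).

Companion of `SelbergSieveGBox` ((9.2) and «`T(r,s) = 0` unless `∏ r_j = ∏ s_j`» on the general box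
`gBox N W`). For an UPPER bound one does not need the exact value (9.5) of `T(r,s)`; this file proves
the CRUDE bounds that suffice for the error terms of Prop. 9.4 (P94, E2b leaf `prop94Z`):

* `abs_pairTerm_le` — `|[cross] μ(d)μ(e)de/∏[d_j,e_j]| ≤ ∏_j (d_j,e_j)`;
* `abs_pairT_le` — `|T(r,s)| ≤ ∏_j G(r_j,s_j)`, `G(u,v) = ∑_{a∣u} ∑_{b∣v} (a,b)` (`gcdDivSum`), with
  `G(pu,v) = 2G(u,v)`, `G(pu,pv) = (p+3)G(u,v)` (`gcdDivSum_prime_mul_left/right/both`);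
* **`sum_prod_gcdDivSum_le`** — Maynard's count, crude form: for `r ∈ box` with `∏ r_j = m`,
  `∑_{s ∈ box, ∏ s_j = m} ∏_j G(r_j,s_j) ≤ ∏_{p∣m} (p + 4|ι| − 1)` (each prime of `m` sits in `s` at
  the position it has in `r` — weight `p+3` — or at one of the `|ι| − 1` others — weight `4`);
* **`sum_abs_pairT_le`** — `U(r) = ∑_{s ∈ box} |T(r,s)| ≤ ∏_{p∣∏r}(p + 4|ι| − 1)`;
* **`abs_quadForm_le`** — `|∑_{r,s} Y_r Y_s T(r,s)| ≤ ∑_r Y_r² ∏_{p∣∏r}(p + 4|ι| − 1)`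
  (`|Y_rY_s| ≤ (Y_r²+Y_s²)/2` and `T(r,s) = T(s,r)`).

All statements are over an arbitrary finite index type `ι`; no named facts.

## References
* J. Maynard, *Dense clusters of primes in subsets*, Compositio Math. 152 (2016), proof of Prop. 9.1
  p. 19 ((9.2), (9.5)), proof of Prop. 9.4 pp. 25–26 [Maynard2016DenseClusters].
* K. Ford, B. Green, S. Konyagin, J. Maynard, T. Tao, *Long gaps between primes*, JAMS 31 (2018),
  (7.5)–(7.7) [FordGreenKonyaginMaynardTao2018].
-/

noncomputable section

open Finset
open scoped ArithmeticFunction.Moebius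

namespace Literature.NumberTheory.Sieve.SelbergBox

variable {ι : Type*} [Fintype ι] [DecidableEq ι]

/-! ### `|pairTerm d e| ≤ ∏ (d_j, e_j)` -/

/-- `|[cross-coprime] μ(d)μ(e) d e/∏_j[d_j,e_j]| ≤ ∏_j (d_j,e_j)` (`d_j e_j = (d_j,e_j)[d_j,e_j]`, `|μ| ≤ 1`).
[cite: Maynard2016DenseClusters, proof of Prop. 9.1 p. 19, (9.2)] -/
theorem abs_pairTerm_le (d e : ι → ℕ) : |pairTerm d e| ≤ ∏ j, (Nat.gcd (d j) (e j) : ℝ) := by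
  have hg0 : (0 : ℝ) ≤ ∏ j, (Nat.gcd (d j) (e j) : ℝ) :=
    Finset.prod_nonneg fun j _ => Nat.cast_nonneg _
  unfold pairTerm
  split_ifs with hc
  · by_cases hz : (∏ j, ((Nat.lcm (d j) (e j) : ℕ) : ℝ)) = 0
    · rw [hz, div_zero, abs_zero]; exact hg0
    · have hprod : (∏ j, (d j : ℝ)) * ∏ j, (e j : ℝ) =
          (∏ j, (Nat.gcd (d j) (e j) : ℝ)) * ∏ j, ((Nat.lcm (d j) (e j) : ℕ) : ℝ) := by
        rw [← Finset.prod_mul_distrib, ← Finset.prod_mul_distrib]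
        refine Finset.prod_congr rfl fun j _ => ?_
        exact_mod_cast (Nat.gcd_mul_lcm (d j) (e j)).symm
      rw [hprod, show ((μ (∏ j, d j) : ℤ) : ℝ) * ((μ (∏ j, e j) : ℤ) : ℝ) *
            ((∏ j, (Nat.gcd (d j) (e j) : ℝ)) * ∏ j, ((Nat.lcm (d j) (e j) : ℕ) : ℝ)) /
              ∏ j, ((Nat.lcm (d j) (e j) : ℕ) : ℝ) =
          ((μ (∏ j, d j) : ℤ) : ℝ) * ((μ (∏ j, e j) : ℤ) : ℝ) * ∏ j, (Nat.gcd (d j) (e j) : ℝ) by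
        field_simp]
      rw [abs_mul, abs_mul]
      have h1 : |((μ (∏ j, d j) : ℤ) : ℝ)| ≤ 1 := by
        exact_mod_cast ArithmeticFunction.abs_moebius_le_one
      have h2 : |((μ (∏ j, e j) : ℤ) : ℝ)| ≤ 1 := by
        exact_mod_cast ArithmeticFunction.abs_moebius_le_one
      rw [abs_of_nonneg hg0]
      calc |((μ (∏ j, d j) : ℤ) : ℝ)| * |((μ (∏ j, e j) : ℤ) : ℝ)| * ∏ j, (Nat.gcd (d j) (e j) : ℝ)
          ≤ 1 * 1 * ∏ j, (Nat.gcd (d j) (e j) : ℝ) := by gcongr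
        _ = ∏ j, (Nat.gcd (d j) (e j) : ℝ) := by ring
  · rw [abs_zero]; exact hg0

/-! ### The divisor gcd sum `G(u,v)` -/

/-- `G(u,v) = ∑_{a∣u} ∑_{b∣v} (a,b)`. [cite: Maynard2016DenseClusters, proof of Prop. 9.1 p. 19 (bounding the local factors)] -/
def gcdDivSum (u v : ℕ) : ℝ := ∑ a ∈ u.divisors, ∑ b ∈ v.divisors, (Nat.gcd a b : ℝ)

/-- `0 ≤ G(u,v)`. [cite: Maynard2016DenseClusters, proof of Prop. 9.1 p. 19] -/
theorem gcdDivSum_nonneg (u v : ℕ) : 0 ≤ gcdDivSum u v :=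
  Finset.sum_nonneg fun _ _ => Finset.sum_nonneg fun _ _ => Nat.cast_nonneg _

/-- `G(u,v) = G(v,u)`. [cite: Maynard2016DenseClusters, proof of Prop. 9.1 p. 19] -/
theorem gcdDivSum_comm (u v : ℕ) : gcdDivSum u v = gcdDivSum v u := by
  unfold gcdDivSum
  rw [Finset.sum_comm]
  exact Finset.sum_congr rfl fun b _ => Finset.sum_congr rfl fun a _ => by rw [Nat.gcd_comm]

/-- `G(1,1) = 1`. [cite: Maynard2016DenseClusters, proof of Prop. 9.1 p. 19] -/
theorem gcdDivSum_one_one : gcdDivSum 1 1 = 1 := by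
  simp [gcdDivSum]

/-- `∑_{a ∣ pu} f(a) = ∑_{a∣u} f(a) + ∑_{a∣u} f(pa)` for a prime `p ∤ u`, `u ≠ 0`.
[cite: Maynard2016DenseClusters, proof of Prop. 9.1 p. 19 (multiplicativity in each prime)] -/
theorem sum_divisors_prime_mul {p u : ℕ} (hp : p.Prime) (hpu : ¬ p ∣ u) (hu : u ≠ 0) (f : ℕ → ℝ) :
    ∑ a ∈ (p * u).divisors, f a = ∑ a ∈ u.divisors, f a + ∑ a ∈ u.divisors, f (p * a) := by
  have hsplit : (p * u).divisors = u.divisors ∪ u.divisors.image (p * ·) := by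
    ext a
    rw [Finset.mem_union, Finset.mem_image, Nat.mem_divisors]
    constructor
    · rintro ⟨ha, -⟩
      by_cases hpa : p ∣ a
      · right
        obtain ⟨c, rfl⟩ := hpa
        exact ⟨c, Nat.mem_divisors.2 ⟨Nat.dvd_of_mul_dvd_mul_left hp.pos ha, hu⟩, rfl⟩
      · left
        have hcop : a.Coprime p := ((Nat.Prime.coprime_iff_not_dvd hp).2 hpa).symm
        exact Nat.mem_divisors.2 ⟨hcop.dvd_of_dvd_mul_left ha, hu⟩
    · rintro (ha | ⟨c, hc, rfl⟩)
      · exact ⟨(Nat.mem_divisors.1 ha).1.trans (Dvd.intro_left p rfl), mul_ne_zero hp.ne_zero hu⟩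
      · exact ⟨mul_dvd_mul_left p (Nat.mem_divisors.1 hc).1, mul_ne_zero hp.ne_zero hu⟩
  have hdisj : Disjoint u.divisors (u.divisors.image (p * ·)) := by
    rw [Finset.disjoint_left]
    intro a ha hima
    obtain ⟨c, -, hca⟩ := Finset.mem_image.1 hima
    exact hpu ((hca ▸ Dvd.intro c rfl : p ∣ a).trans (Nat.mem_divisors.1 ha).1)
  rw [hsplit, Finset.sum_union hdisj, Finset.sum_image]
  intro a _ b _ hab
  exact Nat.eq_of_mul_eq_mul_left hp.pos hab

/-- `G(pu,v) = 2 G(u,v)` for a prime `p ∤ u`, `p ∤ v`. [cite: Maynard2016DenseClusters, proof of Prop. 9.1 p. 19 («if p ∣ r, p ∤ s»)] -/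
theorem gcdDivSum_prime_mul_left {p u v : ℕ} (hp : p.Prime) (hpu : ¬ p ∣ u) (hpv : ¬ p ∣ v)
    (hu : u ≠ 0) : gcdDivSum (p * u) v = 2 * gcdDivSum u v := by
  unfold gcdDivSum
  rw [sum_divisors_prime_mul hp hpu hu, two_mul]
  congr 1
  refine Finset.sum_congr rfl fun a _ => Finset.sum_congr rfl fun b hb => ?_
  have hpb : p.Coprime b :=
    (Nat.Prime.coprime_iff_not_dvd hp).2 fun h => hpv (h.trans (Nat.mem_divisors.1 hb).1)
  rw [Nat.Coprime.gcd_mul_left_cancel a hpb]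

/-- `G(u,pv) = 2 G(u,v)` for a prime `p ∤ u`, `p ∤ v`. [cite: Maynard2016DenseClusters, proof of Prop. 9.1 p. 19 («if p ∤ r, p ∣ s»)] -/
theorem gcdDivSum_prime_mul_right {p u v : ℕ} (hp : p.Prime) (hpu : ¬ p ∣ u) (hpv : ¬ p ∣ v)
    (hv : v ≠ 0) : gcdDivSum u (p * v) = 2 * gcdDivSum u v := by
  rw [gcdDivSum_comm, gcdDivSum_prime_mul_left hp hpv hpu hv, gcdDivSum_comm]

/-- `G(pu,pv) = (p+3) G(u,v)` for a prime `p ∤ u`, `p ∤ v`.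
[cite: Maynard2016DenseClusters, proof of Prop. 9.1 p. 19, (9.5) («if p ∣ (r,s)»)] -/
theorem gcdDivSum_prime_mul_both {p u v : ℕ} (hp : p.Prime) (hpu : ¬ p ∣ u) (hpv : ¬ p ∣ v)
    (hu : u ≠ 0) (hv : v ≠ 0) : gcdDivSum (p * u) (p * v) = ((p : ℝ) + 3) * gcdDivSum u v := by
  unfold gcdDivSum
  rw [sum_divisors_prime_mul hp hpu hu]
  have h1 : ∀ a ∈ u.divisors, ∑ b ∈ (p * v).divisors, (Nat.gcd a b : ℝ) =
      2 * ∑ b ∈ v.divisors, (Nat.gcd a b : ℝ) := by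
    intro a ha
    have hpa : p.Coprime a :=
      (Nat.Prime.coprime_iff_not_dvd hp).2 fun h => hpu (h.trans (Nat.mem_divisors.1 ha).1)
    rw [sum_divisors_prime_mul hp hpv hv, two_mul]
    congr 1
    refine Finset.sum_congr rfl fun b _ => ?_
    rw [Nat.Coprime.gcd_mul_left_cancel_right b hpa]
  have h2 : ∀ a ∈ u.divisors, ∑ b ∈ (p * v).divisors, (Nat.gcd (p * a) b : ℝ) =
      (1 + p) * ∑ b ∈ v.divisors, (Nat.gcd a b : ℝ) := by
    intro a _
    rw [sum_divisors_prime_mul hp hpv hv, add_mul, one_mul, Finset.mul_sum]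
    congr 1
    · refine Finset.sum_congr rfl fun b hb => ?_
      have hpb : p.Coprime b :=
        (Nat.Prime.coprime_iff_not_dvd hp).2 fun h => hpv (h.trans (Nat.mem_divisors.1 hb).1)
      rw [Nat.Coprime.gcd_mul_left_cancel a hpb]
    · refine Finset.sum_congr rfl fun b _ => ?_
      rw [Nat.gcd_mul_left]; push_cast; ring
  rw [Finset.sum_congr rfl h1, Finset.sum_congr rfl h2, ← Finset.mul_sum, ← Finset.mul_sum]
  ring

/-! ### `|T(r,s)| ≤ ∏_j G(r_j,s_j)` -/

/-- `|T(r,s)| ≤ ∑_{d∣r} ∑_{e∣s} ∏_j (d_j,e_j) = ∏_j G(r_j,s_j)` for `r, s ∈ box`.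
[cite: Maynard2016DenseClusters, proof of Prop. 9.1 p. 19 ((9.2): the sum is a product over primes/coordinates)] -/
theorem abs_pairT_le {N W : ι → ℕ} {r s : ι → ℕ} (hr : r ∈ gBox N W) (hs : s ∈ gBox N W) :
    |pairT N W r s| ≤ ∏ j, gcdDivSum (r j) (s j) := by
  unfold pairT
  rw [filter_dvd_eq_piFinset_divisors hr, filter_dvd_eq_piFinset_divisors hs]
  calc |∑ d ∈ Fintype.piFinset (fun j => (r j).divisors),
          ∑ e ∈ Fintype.piFinset (fun j => (s j).divisors), pairTerm d e|
      ≤ ∑ d ∈ Fintype.piFinset (fun j => (r j).divisors),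
          |∑ e ∈ Fintype.piFinset (fun j => (s j).divisors), pairTerm d e| :=
        Finset.abs_sum_le_sum_abs _ _
    _ ≤ ∑ d ∈ Fintype.piFinset (fun j => (r j).divisors),
          ∑ e ∈ Fintype.piFinset (fun j => (s j).divisors), |pairTerm d e| :=
        Finset.sum_le_sum fun d _ => Finset.abs_sum_le_sum_abs _ _
    _ ≤ ∑ d ∈ Fintype.piFinset (fun j => (r j).divisors),
          ∑ e ∈ Fintype.piFinset (fun j => (s j).divisors), ∏ j, (Nat.gcd (d j) (e j) : ℝ) :=
        Finset.sum_le_sum fun d _ => Finset.sum_le_sum fun e _ => abs_pairTerm_le d e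
    _ = ∑ d ∈ Fintype.piFinset (fun j => (r j).divisors),
          ∏ j, ∑ b ∈ (s j).divisors, (Nat.gcd (d j) b : ℝ) := by
        refine Finset.sum_congr rfl fun d _ => ?_
        exact (Finset.prod_univ_sum (fun j => (s j).divisors)
          (fun j b => (Nat.gcd (d j) b : ℝ))).symm
    _ = ∏ j, ∑ a ∈ (r j).divisors, ∑ b ∈ (s j).divisors, (Nat.gcd a b : ℝ) :=
        (Finset.prod_univ_sum (fun j => (r j).divisors)
          (fun j a => ∑ b ∈ (s j).divisors, (Nat.gcd a b : ℝ))).symm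
    _ = ∏ j, gcdDivSum (r j) (s j) := rfl

/-! ### Helpers on vectors -/

/-- `∏_j f_j = f_a · ∏_{j ≠ a} f_j`. [cite: Maynard2016DenseClusters, proof of Prop. 9.1 p. 19] -/
theorem prod_eq_mul_prod_erase (f : ι → ℝ) (a : ι) :
    ∏ j, f j = f a * ∏ j ∈ Finset.univ.erase a, f j :=
  (Finset.mul_prod_erase Finset.univ f (Finset.mem_univ a)).symm

/-- `∏_j s_j = s_b · ∏_{j ∈ univ ∖ {b}} s_j` (ℕ). [cite: Maynard2016DenseClusters, proof of Prop. 9.1 p. 19] -/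
theorem prod_eq_mul_prod_sdiff (s : ι → ℕ) (b : ι) :
    ∏ j, s j = s b * ∏ j ∈ Finset.univ \ {b}, s j := by
  conv_lhs => rw [← Function.update_eq_self b s]
  exact Finset.prod_update_of_mem (Finset.mem_univ b) s (s b)

/-- `∏_j (s/p@b)_j = (∏_j s_j)/p` when `p ∣ s_b`. [cite: Maynard2016DenseClusters, proof of Prop. 9.1 p. 19 (removing p from s)] -/
theorem prod_update_div (s : ι → ℕ) (b : ι) {p : ℕ} (hpb : p ∣ s b) :
    ∏ j, Function.update s b (s b / p) j = (∏ j, s j) / p := by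
  rw [Finset.prod_update_of_mem (Finset.mem_univ b) s (s b / p), prod_eq_mul_prod_sdiff s b]
  exact Nat.div_mul_right_comm hpb _

/-- For `r ∈ box` and a prime `p ∣ r_a`: `p ∤ r_j` for `j ≠ a`. [cite: Maynard2016DenseClusters, §7 p. 13 (components pairwise coprime)] -/
theorem not_dvd_of_ne {N W : ι → ℕ} {r : ι → ℕ} (hr : r ∈ gBox N W) {p : ℕ} (hp : p.Prime)
    {a : ι} (hpa : p ∣ r a) {j : ι} (hj : j ≠ a) : ¬ p ∣ r j := fun h => by
  have hg := Nat.dvd_gcd h hpa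
  rw [(coprime_apply_of_mem_gBox hr hj).gcd_eq_one] at hg
  exact hp.one_lt.ne' (Nat.dvd_one.1 hg)

/-- For `r ∈ box`, `p` prime, `p ∣ r_a`: `p ∤ r_a/p`. [cite: Maynard2016DenseClusters, §7 p. 13 (μ² = 1)] -/
theorem not_dvd_div {N W : ι → ℕ} {r : ι → ℕ} (hr : r ∈ gBox N W) {p : ℕ} (hp : p.Prime)
    {a : ι} (hpa : p ∣ r a) : ¬ p ∣ r a / p := fun h => by
  rw [Nat.dvd_div_iff_mul_dvd hpa] at h
  exact hp.not_isUnit (squarefree_apply_of_mem_gBox hr a p h)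

/-- `∑_b (x if a = b else y) = x + (|ι| − 1) y`. [cite: Maynard2016DenseClusters, proof of Prop. 9.1 p. 19 («ω(p) − 1 possible choices»)] -/
theorem sum_ite_eq_add' (a : ι) (x y : ℝ) :
    ∑ b, (if a = b then x else y) = x + ((Fintype.card ι : ℝ) - 1) * y := by
  have h : ∀ b, (if a = b then x else y) = y + (if a = b then x - y else 0) := by
    intro b; split_ifs <;> ring
  simp_rw [h]
  rw [Finset.sum_add_distrib, Finset.sum_const, Finset.card_univ, nsmul_eq_mul, Finset.sum_ite_eq,
    if_pos (Finset.mem_univ a)]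
  ring

/-! ### Maynard's count on the general box (crude form) -/

/-- **Counting the `s` with `∏ s_j = ∏ r_j`** (crude): for `r ∈ box`, `∏_j r_j = m`:
`∑_{s ∈ box, ∏ s_j = m} ∏_j G(r_j,s_j) ≤ ∏_{p∣m} (p + 4|ι| − 1)` — each prime `p` of `m` lies in
exactly one component of `s`: the one it has in `r` (local factor `G(p·,p·) = (p+3)G`) or one of the
`|ι| − 1` others (local factor `2·2 = 4`). Maynard's exact version has `ω(p) − 1` admissible positions.
[cite: Maynard2016DenseClusters, proof of Prop. 9.1 p. 19 («for each prime p ∣ A there are ω(p) − 1 possible choices of which components of s can be a multiple of p»); proof of Prop. 9.4 p. 25] -/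
theorem sum_prod_gcdDivSum_le (N W : ι → ℕ) :
    ∀ (m : ℕ) (r : ι → ℕ), r ∈ gBox N W → (∏ j, r j) = m →
      ∑ s ∈ (gBox N W).filter (fun s => (∏ j, s j) = m), ∏ j, gcdDivSum (r j) (s j) ≤
        ∏ p ∈ m.primeFactors, ((p : ℝ) + 4 * Fintype.card ι - 1) := by
  classical
  intro m
  induction m using Nat.strong_induction_on with
  | _ m ih =>
    intro r hr hrm
    have hmsq : Squarefree m := hrm ▸ squarefree_of_mem_gBox hr
    have hw0 : ∀ r' s : ι → ℕ, 0 ≤ ∏ j, gcdDivSum (r' j) (s j) := fun r' s =>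
      Finset.prod_nonneg fun j _ => gcdDivSum_nonneg _ _
    by_cases hm1 : m = 1
    · -- base case: `r = s = (1,…,1)`
      have hr1 : r = fun _ => 1 := funext fun i => Nat.dvd_one.1 (by
        rw [← hm1, ← hrm]; exact Finset.dvd_prod_of_mem r (Finset.mem_univ i))
      have hset : (gBox N W).filter (fun s => (∏ j, s j) = m) ⊆ {fun _ => 1} := by
        intro s hs
        rw [Finset.mem_singleton]
        obtain ⟨-, hs1⟩ := Finset.mem_filter.1 hs
        exact funext fun i => Nat.dvd_one.1 (by
          rw [← hm1, ← hs1]; exact Finset.dvd_prod_of_mem s (Finset.mem_univ i))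
      refine (Finset.sum_le_sum_of_subset_of_nonneg hset fun s _ _ => hw0 r s).trans ?_
      rw [Finset.sum_singleton, hm1, Nat.primeFactors_one, Finset.prod_empty, hr1]
      simp [gcdDivSum_one_one]
    · -- peel the least prime `p` of `m`
      have hm0 : 0 < m := Nat.pos_of_ne_zero hmsq.ne_zero
      set p := m.minFac with hpdef
      have hp : p.Prime := Nat.minFac_prime hm1
      have hpm : p ∣ m := Nat.minFac_dvd m
      have hpmem : p ∈ m.primeFactors := Nat.mem_primeFactors.2 ⟨hp, hpm, hmsq.ne_zero⟩
      have hpr : p ∣ ∏ j, r j := by rw [hrm]; exact hpm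
      obtain ⟨a, -, hpa⟩ := (hp.prime.dvd_finsetProd_iff _).1 hpr
      set C : ℝ := 4 * Fintype.card ι - 1 with hC
      have hcard : 1 ≤ Fintype.card ι := Fintype.card_pos_iff.2 ⟨a⟩
      have hC0 : (3 : ℝ) ≤ C := by
        have : (1 : ℝ) ≤ Fintype.card ι := by exact_mod_cast hcard
        rw [hC]; linarith
      -- the reduced `r`
      set r' : ι → ℕ := Function.update r a (r a / p) with hr'def
      have hr'dvd : ∀ j, r' j ∣ r j := fun j => by
        by_cases hj : j = a
        · subst hj; simp only [hr'def, Function.update_self]; exact Nat.div_dvd_of_dvd hpa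
        · simp only [hr'def, Function.update_of_ne hj]; exact dvd_rfl
      have hr' : r' ∈ gBox N W := mem_gBox_of_dvd hr hr'dvd
      have hr'm : (∏ j, r' j) = m / p := by rw [← hrm]; exact prod_update_div r a hpa
      have IH := ih (m / p) (Nat.div_lt_self hm0 hp.one_lt) r' hr' hr'm
      set S := (gBox N W).filter (fun s => (∏ j, s j) = m) with hS
      set S' := (gBox N W).filter (fun s => (∏ j, s j) = m / p) with hS'
      -- Step 1: split the `s`-sum according to the component `b` containing `p`.
      have hstep1 : ∑ s ∈ S, ∏ j, gcdDivSum (r j) (s j) ≤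
          ∑ b, ∑ s ∈ S.filter (fun s => p ∣ s b), ∏ j, gcdDivSum (r j) (s j) := by
        have hb : ∀ b, ∑ s ∈ S.filter (fun s => p ∣ s b), ∏ j, gcdDivSum (r j) (s j) =
            ∑ s ∈ S, if p ∣ s b then ∏ j, gcdDivSum (r j) (s j) else 0 :=
          fun b => Finset.sum_filter _ _
        simp_rw [hb]
        rw [Finset.sum_comm]
        refine Finset.sum_le_sum fun s hs => ?_
        obtain ⟨-, hsm⟩ := Finset.mem_filter.1 hs
        have hps : p ∣ ∏ j, s j := by rw [hsm]; exact hpm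
        obtain ⟨b, -, hpb⟩ := (hp.prime.dvd_finsetProd_iff _).1 hps
        calc ∏ j, gcdDivSum (r j) (s j)
            = (if p ∣ s b then ∏ j, gcdDivSum (r j) (s j) else 0) := by rw [if_pos hpb]
          _ ≤ ∑ b', (if p ∣ s b' then ∏ j, gcdDivSum (r j) (s j) else 0) :=
              Finset.single_le_sum (f := fun b' => if p ∣ s b' then ∏ j, gcdDivSum (r j) (s j) else 0)
                (fun b' _ => by
                  show (0 : ℝ) ≤ if p ∣ s b' then ∏ j, gcdDivSum (r j) (s j) else 0
                  split_ifs
                  · exact hw0 r s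
                  · exact le_rfl)
                (Finset.mem_univ b)
      -- Step 2: for each `b`, remove `p` from `s_b` (and from `r_a`).
      have hstep2 : ∀ b, ∑ s ∈ S.filter (fun s => p ∣ s b), ∏ j, gcdDivSum (r j) (s j) ≤
          (if a = b then (p : ℝ) + 3 else 4) * ∑ s' ∈ S', ∏ j, gcdDivSum (r' j) (s' j) := by
        intro b
        set φ : (ι → ℕ) → (ι → ℕ) := fun s => Function.update s b (s b / p) with hφ
        have hc0 : (0 : ℝ) ≤ if a = b then (p : ℝ) + 3 else 4 := by
          split_ifs
          · positivity
          · norm_num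
        -- pointwise: `∏_j G(r_j,s_j) = c_b ∏_j G(r'_j, (φ s)_j)`
        have hpt : ∀ s ∈ S.filter (fun s => p ∣ s b), ∏ j, gcdDivSum (r j) (s j) =
            (if a = b then (p : ℝ) + 3 else 4) * ∏ j, gcdDivSum (r' j) (φ s j) := by
          intro s hs
          obtain ⟨hsS, hpb⟩ := Finset.mem_filter.1 hs
          obtain ⟨hsbox, -⟩ := Finset.mem_filter.1 hsS
          have hu : r a = p * (r a / p) := (Nat.mul_div_cancel' hpa).symm
          have hv : s b = p * (s b / p) := (Nat.mul_div_cancel' hpb).symm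
          have hpu : ¬ p ∣ r a / p := not_dvd_div hr hp hpa
          have hpv : ¬ p ∣ s b / p := not_dvd_div hsbox hp hpb
          have hu0 : r a / p ≠ 0 := fun h0 => by
            have := one_le_of_mem_gBox hr a
            rw [hu, h0, mul_zero] at this
            exact absurd this (by norm_num)
          have hv0 : s b / p ≠ 0 := fun h0 => by
            have := one_le_of_mem_gBox hsbox b
            rw [hv, h0, mul_zero] at this
            exact absurd this (by norm_num)
          have hr'a : r' a = r a / p := by simp only [hr'def, Function.update_self]
          have hφb : φ s b = s b / p := by simp only [hφ, Function.update_self]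
          have hr'j : ∀ j, j ≠ a → r' j = r j := fun j hj => by
            simp only [hr'def, Function.update_of_ne hj]
          have hφj : ∀ j, j ≠ b → φ s j = s j := fun j hj => by
            simp only [hφ, Function.update_of_ne hj]
          by_cases hab : a = b
          · subst hab
            rw [if_pos rfl, prod_eq_mul_prod_erase (fun j => gcdDivSum (r j) (s j)) a,
              prod_eq_mul_prod_erase (fun j => gcdDivSum (r' j) (φ s j)) a]
            have hrest : ∏ j ∈ Finset.univ.erase a, gcdDivSum (r j) (s j) =
                ∏ j ∈ Finset.univ.erase a, gcdDivSum (r' j) (φ s j) :=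
              Finset.prod_congr rfl fun j hj => by
                rw [hr'j j (Finset.mem_erase.1 hj).1, hφj j (Finset.mem_erase.1 hj).1]
            have hhead : gcdDivSum (r a) (s a) = ((p : ℝ) + 3) * gcdDivSum (r' a) (φ s a) := by
              rw [hr'a, hφb]
              conv_lhs => rw [hu, hv]
              exact gcdDivSum_prime_mul_both hp hpu hpv hu0 hv0
            rw [hrest, hhead]
            ring
          · rw [if_neg hab]
            have hba : b ≠ a := fun h => hab h.symm
            have hbmem : b ∈ Finset.univ.erase a := Finset.mem_erase.2 ⟨hba, Finset.mem_univ b⟩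
            rw [prod_eq_mul_prod_erase (fun j => gcdDivSum (r j) (s j)) a,
              prod_eq_mul_prod_erase (fun j => gcdDivSum (r' j) (φ s j)) a,
              ← Finset.mul_prod_erase _ _ hbmem,
              ← Finset.mul_prod_erase (Finset.univ.erase a) (fun j => gcdDivSum (r' j) (φ s j)) hbmem]
            have hrest : ∏ j ∈ (Finset.univ.erase a).erase b, gcdDivSum (r j) (s j) =
                ∏ j ∈ (Finset.univ.erase a).erase b, gcdDivSum (r' j) (φ s j) :=
              Finset.prod_congr rfl fun j hj => by
                have h1 := Finset.mem_erase.1 hj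
                have h2 := Finset.mem_erase.1 h1.2
                rw [hr'j j h2.1, hφj j h1.1]
            have hpsa : ¬ p ∣ s a := not_dvd_of_ne hsbox hp hpb hab
            have hprb : ¬ p ∣ r b := not_dvd_of_ne hr hp hpa hba
            have hheadA : gcdDivSum (r a) (s a) = 2 * gcdDivSum (r' a) (φ s a) := by
              rw [hr'a, hφj a hab]
              conv_lhs => rw [hu]
              exact gcdDivSum_prime_mul_left hp hpu hpsa hu0
            have hheadB : gcdDivSum (r b) (s b) = 2 * gcdDivSum (r' b) (φ s b) := by
              rw [hr'j b hba, hφb]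
              conv_lhs => rw [hv]
              exact gcdDivSum_prime_mul_right hp hprb hpv hv0
            rw [hrest, hheadA, hheadB]
            ring
        -- `φ` is injective on the slice and maps it into `S'`
        have hinj : Set.InjOn φ ↑(S.filter (fun s => p ∣ s b)) := by
          intro s hs t ht hst
          have hs' := (Finset.mem_filter.1 (Finset.mem_coe.1 hs)).2
          have ht' := (Finset.mem_filter.1 (Finset.mem_coe.1 ht)).2
          funext j
          by_cases hj : j = b
          · subst hj
            have h := congr_fun hst j
            simp only [hφ, Function.update_self] at h
            rw [← Nat.mul_div_cancel' hs', ← Nat.mul_div_cancel' ht', h]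
          · have h := congr_fun hst j
            simp only [hφ, Function.update_of_ne hj] at h
            exact h
        have himg : (S.filter (fun s => p ∣ s b)).image φ ⊆ S' := by
          intro s' hs'
          obtain ⟨s, hs, rfl⟩ := Finset.mem_image.1 hs'
          obtain ⟨hsS, hpb⟩ := Finset.mem_filter.1 hs
          obtain ⟨hsbox, hsm⟩ := Finset.mem_filter.1 hsS
          have hdvd : ∀ j, φ s j ∣ s j := fun j => by
            by_cases hj : j = b
            · subst hj; simp only [hφ, Function.update_self]; exact Nat.div_dvd_of_dvd hpb
            · simp only [hφ, Function.update_of_ne hj]; exact dvd_rfl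
          refine Finset.mem_filter.2 ⟨mem_gBox_of_dvd hsbox hdvd, ?_⟩
          rw [← hsm]
          exact prod_update_div s b hpb
        calc ∑ s ∈ S.filter (fun s => p ∣ s b), ∏ j, gcdDivSum (r j) (s j)
            = ∑ s ∈ S.filter (fun s => p ∣ s b),
                (if a = b then (p : ℝ) + 3 else 4) * ∏ j, gcdDivSum (r' j) (φ s j) :=
              Finset.sum_congr rfl hpt
          _ = (if a = b then (p : ℝ) + 3 else 4) *
                ∑ s ∈ S.filter (fun s => p ∣ s b), ∏ j, gcdDivSum (r' j) (φ s j) := by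
              rw [Finset.mul_sum]
          _ = (if a = b then (p : ℝ) + 3 else 4) *
                ∑ s' ∈ (S.filter (fun s => p ∣ s b)).image φ, ∏ j, gcdDivSum (r' j) (s' j) := by
              rw [Finset.sum_image hinj]
          _ ≤ (if a = b then (p : ℝ) + 3 else 4) * ∑ s' ∈ S', ∏ j, gcdDivSum (r' j) (s' j) :=
              mul_le_mul_of_nonneg_left
                (Finset.sum_le_sum_of_subset_of_nonneg himg fun s' _ _ => hw0 r' s') hc0
      -- Step 3: combine.
      have hIH0 : (0 : ℝ) ≤ ∑ s' ∈ S', ∏ j, gcdDivSum (r' j) (s' j) :=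
        Finset.sum_nonneg fun s' _ => hw0 r' s'
      have hsumc : ∑ b, (if a = b then (p : ℝ) + 3 else 4) = (p : ℝ) + C := by
        rw [sum_ite_eq_add', hC]; ring
      calc ∑ s ∈ S, ∏ j, gcdDivSum (r j) (s j)
          ≤ ∑ b, ∑ s ∈ S.filter (fun s => p ∣ s b), ∏ j, gcdDivSum (r j) (s j) := hstep1
        _ ≤ ∑ b, (if a = b then (p : ℝ) + 3 else 4) * ∑ s' ∈ S', ∏ j, gcdDivSum (r' j) (s' j) :=
            Finset.sum_le_sum fun b _ => hstep2 b
        _ = ((p : ℝ) + C) * ∑ s' ∈ S', ∏ j, gcdDivSum (r' j) (s' j) := by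
            rw [← Finset.sum_mul, hsumc]
        _ ≤ ((p : ℝ) + C) * ∏ q ∈ (m / p).primeFactors, ((q : ℝ) + 4 * Fintype.card ι - 1) :=
            mul_le_mul_of_nonneg_left IH (by positivity)
        _ = ∏ q ∈ m.primeFactors, ((q : ℝ) + 4 * Fintype.card ι - 1) := by
            rw [FGKMT2018.primeFactors_div_of_squarefree hmsq hp hpm, hC,
              show ((p : ℝ) + (4 * Fintype.card ι - 1)) = (p : ℝ) + 4 * Fintype.card ι - 1 by ring,
              Finset.mul_prod_erase _ (fun q : ℕ => ((q : ℝ) + 4 * Fintype.card ι - 1)) hpmem]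

/-! ### `U(r) = ∑_s |T(r,s)|` and the quadratic form -/

/-- **`U(r) = ∑_{s ∈ box} |T(r,s)| ≤ ∏_{p ∣ ∏ r_j} (p + 4|ι| − 1)`** for `r ∈ box`
(`T(r,s) = 0` unless `∏ s = ∏ r`, then `|T| ≤ ∏ G` and the count).
[cite: Maynard2016DenseClusters, proof of Prop. 9.1 p. 19 ((9.5) and the count of s); proof of Prop. 9.4 p. 25] -/
theorem sum_abs_pairT_le {N W : ι → ℕ} {r : ι → ℕ} (hr : r ∈ gBox N W) :
    ∑ s ∈ gBox N W, |pairT N W r s| ≤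
      ∏ p ∈ (∏ j, r j).primeFactors, ((p : ℝ) + 4 * Fintype.card ι - 1) := by
  classical
  have hsplit : ∑ s ∈ gBox N W, |pairT N W r s| =
      ∑ s ∈ (gBox N W).filter (fun s => (∏ j, s j) = ∏ j, r j), |pairT N W r s| := by
    rw [Finset.sum_filter]
    refine Finset.sum_congr rfl fun s hs => ?_
    split_ifs with h
    · rfl
    · rw [pairT_eq_zero_of_prod_ne hr hs (Ne.symm h), abs_zero]
  rw [hsplit]
  calc ∑ s ∈ (gBox N W).filter (fun s => (∏ j, s j) = ∏ j, r j), |pairT N W r s|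
      ≤ ∑ s ∈ (gBox N W).filter (fun s => (∏ j, s j) = ∏ j, r j), ∏ j, gcdDivSum (r j) (s j) :=
        Finset.sum_le_sum fun s hs => abs_pairT_le hr (Finset.mem_filter.1 hs).1
    _ ≤ ∏ p ∈ (∏ j, r j).primeFactors, ((p : ℝ) + 4 * Fintype.card ι - 1) :=
        sum_prod_gcdDivSum_le N W (∏ j, r j) r hr rfl

/-- **The crude bound for the diagonalised quadratic form** (any `Y`):
`|∑_{r,s ∈ box} Y_r Y_s T(r,s)| ≤ ∑_{r ∈ box} Y_r² ∏_{p∣∏r}(p + 4|ι| − 1)`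
(`|Y_r Y_s| ≤ (Y_r² + Y_s²)/2`, `T(r,s) = T(s,r)`, `sum_abs_pairT_le`).
[cite: Maynard2016DenseClusters, proof of Prop. 9.1 p. 19–20; proof of Prop. 9.4 pp. 25–26] -/
theorem abs_quadForm_le (N W : ι → ℕ) (Y : (ι → ℕ) → ℝ) :
    |∑ r ∈ gBox N W, ∑ s ∈ gBox N W, Y r * Y s * pairT N W r s| ≤
      ∑ r ∈ gBox N W, Y r ^ 2 * ∏ p ∈ (∏ j, r j).primeFactors, ((p : ℝ) + 4 * Fintype.card ι - 1) := by
  classical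
  set box := gBox N W with hbox
  set U : (ι → ℕ) → ℝ := fun r => ∑ s ∈ box, |pairT N W r s| with hU
  have h1 : |∑ r ∈ box, ∑ s ∈ box, Y r * Y s * pairT N W r s| ≤
      ∑ r ∈ box, ∑ s ∈ box, (Y r ^ 2 + Y s ^ 2) / 2 * |pairT N W r s| := by
    refine (Finset.abs_sum_le_sum_abs _ _).trans (Finset.sum_le_sum fun r _ => ?_)
    refine (Finset.abs_sum_le_sum_abs _ _).trans (Finset.sum_le_sum fun s _ => ?_)
    rw [abs_mul, abs_mul]
    have hT : 0 ≤ |pairT N W r s| := abs_nonneg _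
    have hY : |Y r| * |Y s| ≤ (Y r ^ 2 + Y s ^ 2) / 2 := by
      have h := sq_nonneg (|Y r| - |Y s|)
      rw [← sq_abs (Y r), ← sq_abs (Y s)]
      nlinarith
    exact mul_le_mul_of_nonneg_right hY hT
  have h2 : ∑ r ∈ box, ∑ s ∈ box, (Y r ^ 2 + Y s ^ 2) / 2 * |pairT N W r s| =
      ∑ r ∈ box, Y r ^ 2 * U r := by
    have hsplit : ∀ r s, (Y r ^ 2 + Y s ^ 2) / 2 * |pairT N W r s| =
        Y r ^ 2 / 2 * |pairT N W r s| + Y s ^ 2 / 2 * |pairT N W r s| := fun r s => by ring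
    simp_rw [hsplit, Finset.sum_add_distrib]
    have hA : ∑ r ∈ box, ∑ s ∈ box, Y r ^ 2 / 2 * |pairT N W r s| =
        ∑ r ∈ box, Y r ^ 2 / 2 * U r := by
      refine Finset.sum_congr rfl fun r _ => ?_
      rw [hU, Finset.mul_sum]
    have hB : ∑ r ∈ box, ∑ s ∈ box, Y s ^ 2 / 2 * |pairT N W r s| =
        ∑ s ∈ box, Y s ^ 2 / 2 * U s := by
      rw [Finset.sum_comm]
      refine Finset.sum_congr rfl fun s _ => ?_
      rw [hU, Finset.mul_sum]
      refine Finset.sum_congr rfl fun r _ => ?_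
      rw [pairT_comm N W r s]
    rw [hA, hB, ← Finset.sum_add_distrib]
    refine Finset.sum_congr rfl fun r _ => ?_
    ring
  refine h1.trans ?_
  rw [h2]
  refine Finset.sum_le_sum fun r hr => ?_
  exact mul_le_mul_of_nonneg_left (sum_abs_pairT_le hr) (sq_nonneg _)

end Literature.NumberTheory.Sieve.SelbergBox
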